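import Mathlib
import Literature.NumberTheory.Sieve.LargestPrimeFactorCubic
import Literature.NumberTheory.Sieve.ShortKloostermanDifferencing
import Literature.NumberTheory.Sieve.DivisorBound
import HarnessLib

/-!
# Heath-Brown's `q`-analogue of van der Corput: the induction step `k → k + 1`
# (PLMS 82 (2001), §9 pp. 36–39)

Topic `Literature/NumberTheory/Sieve`, grouping namespace `ShortKloosterman` (continuation of
`ShortKloostermanDifferencing`).  Heath-Brown proves his Theorem 2
(`Literature.NumberTheory.Sieve.HeathBrown2001_thm2_shortKloosterman`) by induction on the number
`k` of extra factors of the modulus `q = q₀q₁⋯q_k`.  This file PROVES the induction step exactly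
as printed (pp. 36–39 of the held text): with `H = [B/q_k] + 1`, the Weyl shift by multiples of
`q_k` and Cauchy's inequality (9.2) (`vanDerCorput_step'`), the identification (9.3) of the
shifted products with short Kloosterman sums for `(u, v) = (diffNum t f g, diffDen t g)`
(`sum_seqA_add_mul_conj`), the transfer of the non-degeneracy hypothesis
(`not_exists_map_diffNum_eq_mul`), the bookkeeping `∆' = (q₀q_k, whq_k)`,
`∆'' = (q₀, wh)`, `∆ ≤ ∆'' ≤ ∆ (q₀, h)`, `Σ_{h<H} (q₀, h) ≤ d(q₀) H`, and the final choice of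
`H`, giving the level-`k+1` bound from the level-`k` bound for the pair `(u, v)` of degree `≤ 2D`.

The level-`k` statement is `LevelStmt k D P₀` (§1): Theorem 2 at level `k` for polynomials of
degree `≤ D`, with the non-degeneracy hypothesis "no `h` of degree `≤ k + 1` with
`f ≡ g h (mod p)`" required only at the primes `p ∣ q` with `p > P₀` (for `p ≤ P₀` the complete
sums are `O_{P₀}(√p)` trivially, so no hypothesis is needed there; this is how the printed
hypothesis "`p > 2^k D` for all `p ∣ q`" is dispensed with).  The main theorem is
`levelStmt_succ : D ≤ P₀ → LevelStmt k (2D) P₀ → LevelStmt (k+1) D P₀` (§4).  The base case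
`k = 0` (completion + Weil's bound) is `ShortKloostermanLevelZero`.

No named facts are introduced (`LevelStmt` and `hbBound` are definitions with bodies, used as
the induction hypothesis and the right-hand side of Theorem 2).

## References

* D. R. Heath-Brown, *The largest prime factor of `X³ + 2`*, Proc. London Math. Soc. (3) 82
  (2001) 554–596, Theorem 2 and §9 pp. 36–39 (held text
  `paper:heathbrown2001-largest-prime-factor-i-x-i-sup`). [`HeathBrown2001LargestPrimeFactorCubic`]
-/

noncomputable section

open Finset Polynomial

namespace Literature.NumberTheory.Sieve

namespace ShortKloosterman

/-! ### §1. The right-hand side of Theorem 2 and the level-`k` statement -/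

section Defs

/-- **The right-hand side of Heath-Brown's Theorem 2** (without the factor `C q^ε`):
`B (∆/q₀)^{1/2^{k+1}} + B^{1−1/2^k} (q₀/∆)^{1/2^{k+1}} + Σ_{j=1}^{k} B^{1−1/2^j} q_{k+1−j}^{1/2^j}`,
with `qs i = q_{i+1}` and `q_{k+1−j} = qs (j−1).rev` exactly as in
`HeathBrown2001_thm2_shortKloosterman`. [cite: HeathBrown2001LargestPrimeFactorCubic, Thm. 2] -/
def hbBound (k q₀ : ℕ) (qs : Fin k → ℕ) (Δ : ℕ) (B : ℕ) : ℝ :=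
  (B : ℝ) * ((Δ : ℝ) / q₀) ^ ((1 : ℝ) / 2 ^ (k + 1)) +
    (B : ℝ) ^ (1 - (1 : ℝ) / 2 ^ k) * ((q₀ : ℝ) / Δ) ^ ((1 : ℝ) / 2 ^ (k + 1)) +
    ∑ j : Fin k, (B : ℝ) ^ (1 - (1 : ℝ) / 2 ^ (j.val + 1)) *
      (qs j.rev : ℝ) ^ ((1 : ℝ) / 2 ^ (j.val + 1))

/-- `hbBound ≥ 0`. [folklore] -/
theorem hbBound_nonneg (k q₀ : ℕ) (qs : Fin k → ℕ) (Δ B : ℕ) : 0 ≤ hbBound k q₀ qs Δ B := by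
  unfold hbBound
  refine add_nonneg (add_nonneg ?_ ?_) (Finset.sum_nonneg fun j _ => ?_)
  · exact mul_nonneg (Nat.cast_nonneg _) (Real.rpow_nonneg (by positivity) _)
  · exact mul_nonneg (Real.rpow_nonneg (Nat.cast_nonneg _) _) (Real.rpow_nonneg (by positivity) _)
  · exact mul_nonneg (Real.rpow_nonneg (Nat.cast_nonneg _) _) (Real.rpow_nonneg (Nat.cast_nonneg _) _)

/-- **Theorem 2 at level `k`, degree `D`, threshold `P₀`**: for every `ε > 0` there is `C ≥ 0`
such that for all square-free `q = q₀ Π_{i<k} qs i > 0`, all `f, g ∈ ℤ[X]` of degree `≤ D` such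
that for every prime `p ∣ q` with `p > P₀` there is no `h ∈ 𝔽_p[X]` of degree `≤ k + 1` with
`f ≡ g h (mod p)`, and all `w, A ∈ ℤ`, `B ∈ ℕ`,
`|Σ_{A<n≤A+B} e_q(w f(n)\overline{g(n)})| ≤ C q^ε · hbBound k q₀ qs (q₀, w) B`.
(Heath-Brown's Theorem 2 is the case where the non-degeneracy is assumed at every `p ∣ q`.)
[cite: HeathBrown2001LargestPrimeFactorCubic, Thm. 2 and §9] -/
def LevelStmt (k D P₀ : ℕ) : Prop :=
  ∀ ε : ℝ, 0 < ε → ∃ C : ℝ, 0 ≤ C ∧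
    ∀ (q q₀ : ℕ) (qs : Fin k → ℕ) (f g : ℤ[X]) (w A : ℤ) (B : ℕ),
      q = q₀ * ∏ i, qs i → 0 < q → Squarefree q →
      f.natDegree ≤ D → g.natDegree ≤ D →
      (∀ p : ℕ, p.Prime → p ∣ q → P₀ < p → ¬ ∃ h : (ZMod p)[X], h.natDegree ≤ k + 1 ∧
        f.map (Int.castRingHom (ZMod p)) = g.map (Int.castRingHom (ZMod p)) * h) →
      ‖shortKloostermanSum q f g w A B‖ ≤
        C * (q : ℝ) ^ ε * hbBound k q₀ qs (Int.gcd (q₀ : ℤ) w) B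

end Defs

/-! ### §2. Elementary bookkeeping -/

section Bookkeeping

/-- If `g ≡ 0 (mod p)` for a prime `p ∣ q`, the short Kloosterman sum is empty (Heath-Brown
p. 35: "Theorem 2 is trivially true if the polynomial `g(X)` is not coprime to `q`, since the sum
will be empty"). [cite: HeathBrown2001LargestPrimeFactorCubic, §9 p. 35] -/
theorem shortKloostermanSum_eq_zero_of_map_eq_zero {q p : ℕ} [NeZero q] (hp : p.Prime) (hpq : p ∣ q)
    {g : ℤ[X]} (hg : g.map (Int.castRingHom (ZMod p)) = 0) (f : ℤ[X]) (w A : ℤ) (B : ℕ) :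
    shortKloostermanSum q f g w A B = 0 := by
  haveI : Fact p.Prime := ⟨hp⟩
  rw [shortKloostermanSum_eq_sum_phase]
  refine Finset.sum_eq_zero fun n _ => ?_
  unfold phase
  rw [if_neg]
  intro hu
  have h1 : (ZMod.castHom hpq (ZMod p)) ((g.eval n : ℤ) : ZMod q) = 0 := by
    rw [map_intCast]
    have : ((g.eval n : ℤ) : ZMod p) = (g.map (Int.castRingHom (ZMod p))).eval (n : ZMod p) := by
      rw [eval_map, ← eq_intCast (Int.castRingHom (ZMod p)) n, eval₂_at_apply, eq_intCast]
    rw [this, hg, eval_zero]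
  exact not_isUnit_zero (h1 ▸ hu.map (ZMod.castHom hpq (ZMod p)))

/-- `(q₀, h) ≤ Σ_{m ∣ q₀, m ∣ h} m` and hence `Σ_{1 ≤ h < H} (q₀, h) ≤ d(q₀) H` (Heath-Brown
p. 38). [cite: HeathBrown2001LargestPrimeFactorCubic, §9 p. 38] -/
theorem sum_gcd_le_card_divisors_mul {q₀ : ℕ} (hq₀ : 0 < q₀) (H : ℕ) :
    ∑ h ∈ Finset.Ico 1 H, (Nat.gcd q₀ h : ℝ) ≤ (q₀.divisors.card : ℝ) * H := by
  have hstep : ∀ h ∈ Finset.Ico 1 H, (Nat.gcd q₀ h : ℝ) ≤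
      ∑ m ∈ q₀.divisors.filter (fun m => m ∣ h), (m : ℝ) := by
    intro h _
    have hmem : Nat.gcd q₀ h ∈ q₀.divisors.filter (fun m => m ∣ h) := by
      rw [Finset.mem_filter, Nat.mem_divisors]
      exact ⟨⟨Nat.gcd_dvd_left _ _, hq₀.ne'⟩, Nat.gcd_dvd_right _ _⟩
    exact Finset.single_le_sum (s := q₀.divisors.filter (fun m => m ∣ h)) (f := fun m : ℕ => (m : ℝ))
      (fun m _ => Nat.cast_nonneg _) hmem
  refine (Finset.sum_le_sum hstep).trans ?_
  rw [Finset.sum_comm' (t' := q₀.divisors) (s' := fun m => (Finset.Ico 1 H).filter (fun h => m ∣ h))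
    (fun m h => by simp only [Finset.mem_filter]; tauto)]
  have hterm : ∀ m ∈ q₀.divisors, ∑ h ∈ (Finset.Ico 1 H).filter (fun h => m ∣ h), (m : ℝ) ≤ H := by
    intro m hm
    rw [Nat.mem_divisors] at hm
    have hm0 : 0 < m := Nat.pos_of_ne_zero (ne_zero_of_dvd_ne_zero hm.2 hm.1)
    rw [Finset.sum_const, nsmul_eq_mul]
    -- the multiples of `m` in `[1, H)` number at most `H / m`, and `(H/m) m ≤ H`
    have hcard : ((Finset.Ico 1 H).filter (fun h => m ∣ h)).card ≤ H / m := by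
      have hsub : (Finset.Ico 1 H).filter (fun h => m ∣ h) ⊆
          (Finset.Ioc 0 (H / m)).image (fun b => m * b) := by
        intro h hh
        rw [Finset.mem_filter, Finset.mem_Ico] at hh
        obtain ⟨⟨h1, hH⟩, ⟨b, rfl⟩⟩ := hh
        rw [Finset.mem_image]
        refine ⟨b, Finset.mem_Ioc.mpr ⟨Nat.pos_of_mul_pos_left h1, ?_⟩, rfl⟩
        exact (Nat.le_div_iff_mul_le hm0).mpr (by rw [Nat.mul_comm]; exact hH.le)
      exact (Finset.card_le_card hsub).trans (Finset.card_image_le.trans (by simp))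
    calc (((Finset.Ico 1 H).filter (fun h => m ∣ h)).card : ℝ) * m ≤ ((H / m : ℕ) : ℝ) * m := by
          gcongr
      _ = ((H / m * m : ℕ) : ℝ) := by push_cast; ring
      _ ≤ H := by exact_mod_cast Nat.div_mul_le_self H m
  refine (Finset.sum_le_sum hterm).trans ?_
  rw [Finset.sum_const, nsmul_eq_mul]

/-- `∆ = (q₀, w)` divides `∆'' = (q₀, wh)`, which divides `∆ · (q₀, h)` (Heath-Brown p. 38:
"`∆'' = (q₀, wh) ≤ (q₀, w)(q₀, h) = ∆ (q₀, h)`"). [cite: HeathBrown2001LargestPrimeFactorCubic, §9 p. 38] -/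
theorem gcd_dvd_gcd_mul_and (q₀ : ℕ) (w : ℤ) (h : ℕ) :
    Int.gcd (q₀ : ℤ) w ∣ Int.gcd (q₀ : ℤ) (w * h) ∧
      Int.gcd (q₀ : ℤ) (w * h) ∣ Int.gcd (q₀ : ℤ) w * Nat.gcd q₀ h := by
  refine ⟨Int.gcd_dvd_gcd_mul_right_right _ _ _, ?_⟩
  rw [Int.gcd_eq_natAbs, Int.gcd_eq_natAbs, Int.natAbs_mul, Int.natAbs_natCast, Int.natAbs_natCast]
  exact gcd_mul_dvd_mul_gcd q₀ w.natAbs h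

/-- `(q₀ r, w h r) = r · (q₀, w h)` (Heath-Brown p. 38: `∆' = (q'₀, whq_k)` with `q'₀ = q₀q_k`).
[cite: HeathBrown2001LargestPrimeFactorCubic, §9 p. 38] -/
theorem gcd_mul_eq (q₀ r : ℕ) (w : ℤ) (h : ℕ) :
    Int.gcd ((q₀ * r : ℕ) : ℤ) (w * ((h * r : ℕ) : ℤ)) = r * Int.gcd (q₀ : ℤ) (w * h) := by
  have : w * ((h * r : ℕ) : ℤ) = (w * h) * (r : ℤ) := by push_cast; ring
  rw [this, Nat.cast_mul, Int.gcd_mul_right, Int.natAbs_natCast, mul_comm]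

end Bookkeeping

/-! ### §3. Properties of `hbBound` -/

section Bound

/-- Monotonicity in `B`. [folklore] -/
theorem hbBound_mono {k q₀ : ℕ} (qs : Fin k → ℕ) (Δ : ℕ) {B B' : ℕ} (h : B' ≤ B) :
    hbBound k q₀ qs Δ B' ≤ hbBound k q₀ qs Δ B := by
  unfold hbBound
  have hB : (B' : ℝ) ≤ B := by exact_mod_cast h
  have hexp : ∀ j : ℕ, 0 ≤ 1 - (1 : ℝ) / 2 ^ j := fun j => by
    rw [sub_nonneg, div_le_one (by positivity)]
    exact one_le_pow₀ (by norm_num)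
  refine add_le_add (add_le_add ?_ ?_) (Finset.sum_le_sum fun j _ => ?_)
  · exact mul_le_mul_of_nonneg_right hB (Real.rpow_nonneg (by positivity) _)
  · exact mul_le_mul_of_nonneg_right (Real.rpow_le_rpow (Nat.cast_nonneg _) hB (hexp k))
      (Real.rpow_nonneg (by positivity) _)
  · exact mul_le_mul_of_nonneg_right (Real.rpow_le_rpow (Nat.cast_nonneg _) hB (hexp _))
      (Real.rpow_nonneg (Nat.cast_nonneg _) _)

/-- **The effect of replacing `(q₀, ∆)` by `(q₀ r, ∆')`** with `∆'/(q₀ r) = ∆''/q₀` and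
`∆ ∣ ∆'' ∣ ∆ t` (`t = (q₀, h) ≥ 1`): the level-`k` bound grows at most by the factor `t`
(Heath-Brown p. 38, "In view of our choice of the `q'_i` we conclude that …").
[cite: HeathBrown2001LargestPrimeFactorCubic, §9 p. 38] -/
theorem hbBound_le_mul_of_dvd {k q₀ r : ℕ} (hq₀ : 0 < q₀) (hr : 0 < r) (qs : Fin k → ℕ)
    {Δ Δ'' t : ℕ} (hΔ : 0 < Δ) (ht : 0 < t) (h1 : Δ ∣ Δ'') (h2 : Δ'' ∣ Δ * t) (B : ℕ) :
    hbBound k (q₀ * r) qs (r * Δ'') B ≤ t * hbBound k q₀ qs Δ B := by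
  unfold hbBound
  set e : ℝ := (1 : ℝ) / 2 ^ (k + 1) with he
  have he0 : 0 ≤ e := by positivity
  have he1 : e ≤ 1 := by
    rw [he, div_le_one (by positivity)]; exact one_le_pow₀ (by norm_num)
  have hΔ''0 : 0 < Δ'' := Nat.pos_of_ne_zero fun h0 => by
    rw [h0, zero_dvd_iff] at h2; exact (Nat.mul_pos hΔ ht).ne' h2
  have ht1 : (1 : ℝ) ≤ t := by exact_mod_cast ht
  have hq₀' : (0 : ℝ) < q₀ := by exact_mod_cast hq₀
  have hr' : (0 : ℝ) < r := by exact_mod_cast hr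
  have hΔ' : (0 : ℝ) < Δ := by exact_mod_cast hΔ
  have hΔ''' : (0 : ℝ) < Δ'' := by exact_mod_cast hΔ''0
  -- the ratio `∆'/(q₀ r) = ∆''/q₀`
  have hratio : (((r * Δ'' : ℕ) : ℝ) / ((q₀ * r : ℕ) : ℝ)) = (Δ'' : ℝ) / q₀ := by
    push_cast; field_simp
  have hratio' : (((q₀ * r : ℕ) : ℝ) / ((r * Δ'' : ℕ) : ℝ)) = (q₀ : ℝ) / Δ'' := by
    push_cast; field_simp
  rw [hratio, hratio']
  -- `∆ ≤ ∆'' ≤ ∆ t`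
  have hup : (Δ'' : ℝ) ≤ Δ * t := by exact_mod_cast Nat.le_of_dvd (Nat.mul_pos hΔ ht) h2
  have hlow : (Δ : ℝ) ≤ Δ'' := by exact_mod_cast Nat.le_of_dvd hΔ''0 h1
  have hte : (t : ℝ) ^ e ≤ t := by
    conv_rhs => rw [← Real.rpow_one (t : ℝ)]
    exact Real.rpow_le_rpow_of_exponent_le ht1 he1
  have hte1 : (1 : ℝ) ≤ (t : ℝ) ^ e := Real.one_le_rpow ht1 he0
  -- first term
  have hT1 : ((Δ'' : ℝ) / q₀) ^ e ≤ t * ((Δ : ℝ) / q₀) ^ e := by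
    calc ((Δ'' : ℝ) / q₀) ^ e ≤ ((Δ : ℝ) * t / q₀) ^ e :=
          Real.rpow_le_rpow (by positivity) (div_le_div_of_nonneg_right hup hq₀'.le) he0
      _ = (t : ℝ) ^ e * ((Δ : ℝ) / q₀) ^ e := by
          rw [mul_div_right_comm, Real.mul_rpow (by positivity) (by positivity), mul_comm]
      _ ≤ t * ((Δ : ℝ) / q₀) ^ e :=
          mul_le_mul_of_nonneg_right hte (Real.rpow_nonneg (by positivity) _)
  -- second term
  have hT2 : ((q₀ : ℝ) / Δ'') ^ e ≤ t * ((q₀ : ℝ) / Δ) ^ e := by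
    calc ((q₀ : ℝ) / Δ'') ^ e ≤ ((q₀ : ℝ) / Δ) ^ e :=
          Real.rpow_le_rpow (by positivity) (div_le_div_of_nonneg_left hq₀'.le hΔ' hlow) he0
      _ ≤ t * ((q₀ : ℝ) / Δ) ^ e := le_mul_of_one_le_left (Real.rpow_nonneg (by positivity) _) ht1
  have hB0 : (0 : ℝ) ≤ B := Nat.cast_nonneg _
  have hS0 : 0 ≤ ∑ j : Fin k, (B : ℝ) ^ (1 - (1 : ℝ) / 2 ^ (j.val + 1)) *
      (qs j.rev : ℝ) ^ ((1 : ℝ) / 2 ^ (j.val + 1)) :=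
    Finset.sum_nonneg fun j _ => mul_nonneg (Real.rpow_nonneg hB0 _) (Real.rpow_nonneg (Nat.cast_nonneg _) _)
  rw [mul_add, mul_add]
  refine add_le_add (add_le_add ?_ ?_) ?_
  · calc (B : ℝ) * ((Δ'' : ℝ) / q₀) ^ e ≤ (B : ℝ) * (t * ((Δ : ℝ) / q₀) ^ e) :=
          mul_le_mul_of_nonneg_left hT1 hB0
      _ = t * ((B : ℝ) * ((Δ : ℝ) / q₀) ^ e) := by ring
  · calc (B : ℝ) ^ (1 - (1 : ℝ) / 2 ^ k) * ((q₀ : ℝ) / Δ'') ^ e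
        ≤ (B : ℝ) ^ (1 - (1 : ℝ) / 2 ^ k) * (t * ((q₀ : ℝ) / Δ) ^ e) :=
          mul_le_mul_of_nonneg_left hT2 (Real.rpow_nonneg hB0 _)
      _ = t * ((B : ℝ) ^ (1 - (1 : ℝ) / 2 ^ k) * ((q₀ : ℝ) / Δ) ^ e) := by ring
  · exact le_mul_of_one_le_left hS0 ht1

/-- Reindexing the level-`k+1` sum: the term `j = 0` is `B^{1/2} q_{k+1}^{1/2}` and the terms
`j = i + 1` are those of level `k` for `qs' = qs ∘ castSucc` with halved exponents. [folklore] -/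
theorem hbBound_succ (k q₀ : ℕ) (qs : Fin (k + 1) → ℕ) (Δ B : ℕ) :
    hbBound (k + 1) q₀ qs Δ B =
      (B : ℝ) * ((Δ : ℝ) / q₀) ^ ((1 : ℝ) / 2 ^ (k + 1 + 1)) +
      (B : ℝ) ^ (1 - (1 : ℝ) / 2 ^ (k + 1)) * ((q₀ : ℝ) / Δ) ^ ((1 : ℝ) / 2 ^ (k + 1 + 1)) +
      ((B : ℝ) ^ (1 - (1 : ℝ) / 2 ^ (0 + 1)) * (qs (Fin.last k) : ℝ) ^ ((1 : ℝ) / 2 ^ (0 + 1)) +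
        ∑ i : Fin k, (B : ℝ) ^ (1 - (1 : ℝ) / 2 ^ (i.val + 1 + 1)) *
          (qs i.rev.castSucc : ℝ) ^ ((1 : ℝ) / 2 ^ (i.val + 1 + 1))) := by
  unfold hbBound
  rw [Fin.sum_univ_succ]
  simp only [Fin.val_zero, Fin.val_succ, Fin.rev_zero, Fin.rev_succ]

/-- `Σ u_j² ≤ (Σ u_j)²` for `u_j ≥ 0`. [folklore] -/
theorem sum_sq_le_sq_sum {ι : Type*} (s : Finset ι) {u : ι → ℝ} (hu : ∀ j, 0 ≤ u j) :
    ∑ j ∈ s, u j ^ 2 ≤ (∑ j ∈ s, u j) ^ 2 := by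
  classical
  induction s using Finset.induction_on with
  | empty => simp
  | insert j s hj ih =>
    rw [Finset.sum_insert hj, Finset.sum_insert hj]
    have hs : 0 ≤ ∑ i ∈ s, u i := Finset.sum_nonneg fun i _ => hu i
    nlinarith [hu j]

/-- `B · B^{1−a} x^c = (B^{1 − a/2} x^{c/2})²` for `B, x ≥ 0`, `a ≤ 1`. [folklore] -/
theorem mul_rpow_mul_rpow_eq_sq {B x a c : ℝ} (hB : 0 ≤ B) (hx : 0 ≤ x) (ha1 : a ≤ 1) :
    B * (B ^ (1 - a) * x ^ c) = (B ^ (1 - a / 2) * x ^ (c / 2)) ^ 2 := by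
  rcases eq_or_lt_of_le hB with hB0 | hB0
  · rw [← hB0]
    have : (1 : ℝ) - a / 2 ≠ 0 := by linarith
    rw [Real.zero_rpow this]; simp
  · rw [mul_pow, ← Real.rpow_natCast (B ^ (1 - a / 2)), ← Real.rpow_natCast (x ^ (c / 2)),
      ← Real.rpow_mul hB0.le, ← Real.rpow_mul hx]
    push_cast
    have e1 : (1 - a / 2) * 2 = 1 + (1 - a) := by ring
    have e2 : c / 2 * 2 = c := by ring
    rw [e1, e2, Real.rpow_add hB0, Real.rpow_one, mul_assoc]

/-- `B · B x^c = (B x^{c/2})²` for `B, x ≥ 0`. [folklore] -/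
theorem mul_mul_rpow_eq_sq {B x c : ℝ} (hB : 0 ≤ B) (hx : 0 ≤ x) :
    B * (B * x ^ c) = (B * x ^ (c / 2)) ^ 2 := by
  have h := mul_rpow_mul_rpow_eq_sq (a := 0) (c := c) hB hx zero_le_one
  rw [sub_zero, Real.rpow_one, zero_div, sub_zero, Real.rpow_one] at h
  exact h

/-- `B r = (B^{1 − 1/2} r^{1/2})²` for `B, r ≥ 0`. [folklore] -/
theorem mul_eq_rpow_sq {B r : ℝ} (hB : 0 ≤ B) (hr : 0 ≤ r) :
    B * r = (B ^ (1 - (1 : ℝ) / 2 ^ (0 + 1)) * r ^ ((1 : ℝ) / 2 ^ (0 + 1))) ^ 2 := by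
  rw [mul_pow, ← Real.rpow_natCast (B ^ _), ← Real.rpow_natCast (r ^ _), ← Real.rpow_mul hB,
    ← Real.rpow_mul hr]
  norm_num

/-- **Taking square roots in the induction step** (Heath-Brown p. 39): with `q_{k+1}` the last
factor and `qs' = qs ∘ castSucc`,
`√(B q_{k+1} + B · hbBound k q₀ qs' ∆ B) ≤ hbBound (k+1) q₀ qs ∆ B`.
[cite: HeathBrown2001LargestPrimeFactorCubic, §9 p. 39] -/
theorem sqrt_le_hbBound_succ (k q₀ : ℕ) (qs : Fin (k + 1) → ℕ) (Δ B : ℕ) :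
    Real.sqrt ((B : ℝ) * (qs (Fin.last k) : ℝ) +
      (B : ℝ) * hbBound k q₀ (fun i => qs i.castSucc) Δ B) ≤ hbBound (k + 1) q₀ qs Δ B := by
  have hB0 : (0 : ℝ) ≤ B := Nat.cast_nonneg _
  have hkle : (1 : ℝ) / 2 ^ k ≤ 1 := by
    rw [div_le_one (by positivity)]; exact one_le_pow₀ (by norm_num)
  have hale : ∀ i : ℕ, (1 : ℝ) / 2 ^ (i + 1) ≤ 1 := fun i => by
    rw [div_le_one (by positivity)]; exact one_le_pow₀ (by norm_num)
  rw [Real.sqrt_le_left (hbBound_nonneg _ _ _ _ _), hbBound_succ]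
  simp only [hbBound]
  rw [mul_add, mul_add, Finset.mul_sum]
  -- write every piece of the left-hand side as a square
  rw [mul_eq_rpow_sq hB0 (Nat.cast_nonneg _), mul_mul_rpow_eq_sq hB0 (by positivity),
    mul_rpow_mul_rpow_eq_sq hB0 (by positivity) hkle,
    Finset.sum_congr rfl fun i _ => mul_rpow_mul_rpow_eq_sq hB0 (Nat.cast_nonneg _) (hale _)]
  -- align the exponents with those of level `k + 1`
  have he2 : ((1 : ℝ) / 2 ^ (k + 1)) / 2 = (1 : ℝ) / 2 ^ (k + 1 + 1) := by
    rw [pow_succ (2 : ℝ) (k + 1)]; ring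
  have hk2 : (1 : ℝ) - ((1 : ℝ) / 2 ^ k) / 2 = 1 - (1 : ℝ) / 2 ^ (k + 1) := by
    rw [pow_succ]; ring
  have ha2' : ∀ i : ℕ, ((1 : ℝ) / 2 ^ (i + 1)) / 2 = (1 : ℝ) / 2 ^ (i + 1 + 1) := by
    intro i; rw [pow_succ (2 : ℝ) (i + 1)]; ring
  rw [he2, hk2]
  simp only [ha2']
  -- `U0² + (U1² + U2² + Σ U3²) ≤ (U1 + U2 + (U0 + Σ U3))²`
  set U0 := (B : ℝ) ^ (1 - (1 : ℝ) / 2 ^ (0 + 1)) * (qs (Fin.last k) : ℝ) ^ ((1 : ℝ) / 2 ^ (0 + 1))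
  set U1 := (B : ℝ) * ((Δ : ℝ) / q₀) ^ ((1 : ℝ) / 2 ^ (k + 1 + 1))
  set U2 := (B : ℝ) ^ (1 - (1 : ℝ) / 2 ^ (k + 1)) * ((q₀ : ℝ) / Δ) ^ ((1 : ℝ) / 2 ^ (k + 1 + 1))
  set U3 : Fin k → ℝ := fun i => (B : ℝ) ^ (1 - (1 : ℝ) / 2 ^ (i.val + 1 + 1)) *
    (qs i.rev.castSucc : ℝ) ^ ((1 : ℝ) / 2 ^ (i.val + 1 + 1)) with hU3
  have hU0 : 0 ≤ U0 := by positivity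
  have hU1 : 0 ≤ U1 := by positivity
  have hU2 : 0 ≤ U2 := by positivity
  have hU3 : ∀ i, 0 ≤ U3 i := fun i => by positivity
  have hS3 : 0 ≤ ∑ i, U3 i := Finset.sum_nonneg fun i _ => hU3 i
  have hsq : ∑ i : Fin k, U3 i ^ 2 ≤ (∑ i, U3 i) ^ 2 := sum_sq_le_sq_sum _ hU3
  change U0 ^ 2 + (U1 ^ 2 + U2 ^ 2 + ∑ i : Fin k, U3 i ^ 2) ≤ (U1 + U2 + (U0 + ∑ i, U3 i)) ^ 2
  nlinarith [mul_nonneg hU0 hU1, mul_nonneg hU0 hU2, mul_nonneg hU1 hU2, mul_nonneg hU0 hS3,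
    mul_nonneg hU1 hS3, mul_nonneg hU2 hS3]

end Bound


/-! ### §4. The induction step -/

section Step

open Literature.NumberTheory.LFunctions.VdC (corr)

/-- **Heath-Brown's induction step** (§9 pp. 36–39): Theorem 2 at level `k` for polynomials of
degree `≤ 2D` implies Theorem 2 at level `k + 1` for polynomials of degree `≤ D`, with the same
non-degeneracy threshold `P₀ ≥ D` (the transfer lemma needs `p > D`).  The constant at level
`k + 1` is `2 √(max(1, C_k(ε/4)) · C_d(ε/4))`, `C_d` the divisor-bound constant.
[cite: HeathBrown2001LargestPrimeFactorCubic, §9 pp. 36–39] -/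
theorem levelStmt_succ {k D P₀ : ℕ} (hDP : D ≤ P₀) (IH : LevelStmt k (2 * D) P₀) :
    LevelStmt (k + 1) D P₀ := by
  intro ε hε
  have hε4 : 0 < ε / 4 := by linarith
  obtain ⟨Ck, hCk0, hCk⟩ := IH (ε / 4) hε4
  obtain ⟨Cd, hCd1, hCd⟩ := exists_card_divisors_le_mul_rpow hε4
  set M : ℝ := max 1 Ck with hM
  have hM1 : 1 ≤ M := le_max_left _ _
  have hMC : Ck ≤ M := le_max_right _ _
  have hCd0 : 0 < Cd := lt_of_lt_of_le one_pos hCd1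
  refine ⟨2 * Real.sqrt (M * Cd), by positivity, ?_⟩
  intro q q₀ qs f g w A B hq hq0 hsq hf hg hnd
  haveI : NeZero q := ⟨hq0.ne'⟩
  -- the factorisation `q = (q₀ r) · Π_{i<k} qs i` with `r = q_{k+1}` the last factor
  set r : ℕ := qs (Fin.last k) with hr
  set qs' : Fin k → ℕ := fun i => qs i.castSucc with hqs'
  have hqfac : q = q₀ * r * ∏ i, qs' i := by
    rw [hq, Fin.prod_univ_castSucc]; ring
  have hq₀ : 0 < q₀ := Nat.pos_of_ne_zero fun h0 => by rw [h0, zero_mul] at hq; omega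
  have hr0 : 0 < r := Nat.pos_of_ne_zero fun h0 => by
    rw [hqfac, h0, mul_zero, zero_mul] at hq0; exact lt_irrefl 0 hq0
  have hq1 : (1 : ℝ) ≤ q := by exact_mod_cast hq0
  have hq₀q : (q₀ : ℝ) ≤ q := by
    have : q₀ ∣ q := by rw [hq]; exact dvd_mul_right _ _
    exact_mod_cast Nat.le_of_dvd hq0 this
  set Δ : ℕ := Int.gcd (q₀ : ℤ) w with hΔ
  have hΔ0 : 0 < Δ := Int.gcd_pos_of_ne_zero_left _ (by exact_mod_cast hq₀.ne')
  have hRHS0 : 0 ≤ 2 * Real.sqrt (M * Cd) * (q : ℝ) ^ ε * hbBound (k + 1) q₀ qs Δ B := by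
    have := hbBound_nonneg (k + 1) q₀ qs Δ B
    positivity
  -- trivial cases: `B = 0`, or `g ≡ 0 (mod p)` for some `p ∣ q`
  rcases Nat.eq_zero_or_pos B with hB0 | hBpos
  · rw [hB0, shortKloostermanSum_zero, norm_zero]; rw [hB0] at hRHS0; exact hRHS0
  by_cases hgp : ∃ p : ℕ, p.Prime ∧ p ∣ q ∧ g.map (Int.castRingHom (ZMod p)) = 0
  · obtain ⟨p, hp, hpq, hg0⟩ := hgp
    rw [shortKloostermanSum_eq_zero_of_map_eq_zero hp hpq hg0, norm_zero]; exact hRHS0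
  simp only [not_exists, not_and] at hgp
  -- `H = [B/r] + 1`
  set H : ℕ := B / r + 1 with hH
  have hH1 : 1 ≤ H := Nat.le_add_left 1 _
  have hHr : (H - 1) * r ≤ B := by rw [hH, Nat.add_sub_cancel]; exact Nat.div_mul_le_self B r
  have hBH : B < H * r := by rw [hH, add_mul, one_mul]; exact Nat.lt_div_mul_add hr0
  have hHpos : (0 : ℝ) < H := by exact_mod_cast hH1
  -- (9.2)
  have hHr' : (((H - 1) * r : ℕ) : ℤ) ≤ (A + (B : ℕ)) - A := by
    rw [show (A + (B : ℕ) : ℤ) - A = B by ring]; exact_mod_cast hHr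
  have h92 := vanDerCorput_step' (z := seqA q f g w A B) (a := A) (b := A + (B : ℕ))
    (fun n hn => seqA_eq_zero_of_not_mem hn) (norm_seqA_le q f g w A B) hr0 hH1 hHr'
  rw [sum_seqA] at h92
  have hBab : (((A + (B : ℕ) : ℤ) : ℝ) - (A : ℝ)) = B := by push_cast; ring
  rw [hBab] at h92
  -- the shifted products are short Kloosterman sums for `(u, v)`, bounded by the level-`k` statement
  set Ψ : ℝ := hbBound k q₀ qs' Δ B with hΨ
  have hΨ0 : 0 ≤ Ψ := hbBound_nonneg _ _ _ _ _
  have hQ1 : (1 : ℝ) ≤ (q : ℝ) ^ (ε / 4) := Real.one_le_rpow hq1 hε4.le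
  have hcorr : ∀ h ∈ Finset.Ico 1 H,
      ‖corr (seqA q f g w A B) A (A + (B : ℕ)) ((h * r : ℕ) : ℤ)‖ ≤
        Ck * (q : ℝ) ^ (ε / 4) * ((Nat.gcd q₀ h : ℕ) * Ψ) := by
    intro h hh
    rw [Finset.mem_Ico] at hh
    have hhr : h * r ≤ B := (Nat.mul_le_mul_right r (by omega : h ≤ H - 1)).trans hHr
    have hid : corr (seqA q f g w A B) A (A + (B : ℕ)) ((h * r : ℕ) : ℤ) =
        shortKloostermanSum q (diffNum ((h * r : ℕ) : ℤ) f g) (diffDen ((h * r : ℕ) : ℤ) g)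
          (w * ((h * r : ℕ) : ℤ)) A (B - h * r) := by
      simp only [corr]
      exact sum_seqA_add_mul_conj q f g w A hhr
    rw [hid]
    -- apply the level-`k` statement to `(u, v)` of degree `≤ 2D`, modulus `(q₀ r) · Π qs'`
    have hnd' : ∀ p : ℕ, p.Prime → p ∣ q → P₀ < p → ¬ ∃ h' : (ZMod p)[X], h'.natDegree ≤ k + 1 ∧
        (diffNum ((h * r : ℕ) : ℤ) f g).map (Int.castRingHom (ZMod p)) =
          (diffDen ((h * r : ℕ) : ℤ) g).map (Int.castRingHom (ZMod p)) * h' := by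
      intro p hp hpq hP
      haveI : Fact p.Prime := ⟨hp⟩
      exact not_exists_map_diffNum_eq_mul (lt_of_le_of_lt hDP hP) hf hg (hgp p hp hpq)
        (hnd p hp hpq hP) _
    have hb := hCk q (q₀ * r) qs' (diffNum ((h * r : ℕ) : ℤ) f g) (diffDen ((h * r : ℕ) : ℤ) g)
      (w * ((h * r : ℕ) : ℤ)) A (B - h * r) hqfac hq0 hsq (natDegree_diffNum_le hf hg)
      (natDegree_diffDen_le hg) hnd'
    refine hb.trans ?_
    refine mul_le_mul_of_nonneg_left ?_ (by positivity)
    -- `∆' = r ∆''`, `∆ ∣ ∆'' ∣ ∆ (q₀, h)`, `B − hr ≤ B`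
    rw [gcd_mul_eq]
    obtain ⟨h1, h2⟩ := gcd_dvd_gcd_mul_and q₀ w h
    have ht : 0 < Nat.gcd q₀ h := Nat.gcd_pos_of_pos_left _ hq₀
    calc hbBound k (q₀ * r) qs' (r * Int.gcd (q₀ : ℤ) (w * h)) (B - h * r)
        ≤ hbBound k (q₀ * r) qs' (r * Int.gcd (q₀ : ℤ) (w * h)) B := hbBound_mono _ _ (Nat.sub_le _ _)
      _ ≤ (Nat.gcd q₀ h : ℕ) * Ψ := hbBound_le_mul_of_dvd hq₀ hr0 qs' hΔ0 ht h1 h2 B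
  -- `Σ_{h<H} ‖C(hr)‖ ≤ C_k q^{ε/4} Ψ d(q₀) H`
  set τ : ℝ := (q₀.divisors.card : ℝ) with hτ
  have hτ1 : 1 ≤ τ := by
    rw [hτ]; exact_mod_cast Finset.card_pos.mpr ⟨1, Nat.one_mem_divisors.mpr hq₀.ne'⟩
  have hT : ∑ h ∈ Finset.Ico 1 H, ‖corr (seqA q f g w A B) A (A + (B : ℕ)) ((h * r : ℕ) : ℤ)‖ ≤
      Ck * (q : ℝ) ^ (ε / 4) * Ψ * (τ * H) := by
    refine (Finset.sum_le_sum hcorr).trans ?_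
    have hre : ∀ h ∈ Finset.Ico 1 H, Ck * (q : ℝ) ^ (ε / 4) * ((Nat.gcd q₀ h : ℕ) * Ψ) =
        Ck * (q : ℝ) ^ (ε / 4) * Ψ * (Nat.gcd q₀ h : ℕ) := fun h _ => by ring
    rw [Finset.sum_congr rfl hre, ← Finset.mul_sum]
    exact mul_le_mul_of_nonneg_left (sum_gcd_le_card_divisors_mul hq₀ H) (by positivity)
  -- combine with (9.2): `S² ≤ 2 B r + 4 B C_k q^{ε/4} Ψ τ ≤ 4 M τ q^{ε/4} (B r + B Ψ)`
  set S : ℝ := ‖shortKloostermanSum q f g w A B‖ with hS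
  have hS0 : 0 ≤ S := norm_nonneg _
  have hB1 : (0 : ℝ) < B := by exact_mod_cast hBpos
  have hBr : (B : ℝ) ≤ H * r := by exact_mod_cast hBH.le
  have h1 : (H : ℝ) ^ 2 * S ^ 2 ≤ (H : ℝ) * (2 * (B : ℝ) ^ 2 + 4 * B * H * (Ck * (q : ℝ) ^ (ε / 4) * Ψ * τ)) := by
    calc (H : ℝ) ^ 2 * S ^ 2 ≤ 2 * (B : ℝ) ^ 2 * H + 4 * (B : ℝ) * H *
          ∑ h ∈ Finset.Ico 1 H, ‖corr (seqA q f g w A B) A (A + (B : ℕ)) ((h * r : ℕ) : ℤ)‖ := h92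
      _ ≤ 2 * (B : ℝ) ^ 2 * H + 4 * (B : ℝ) * H * (Ck * (q : ℝ) ^ (ε / 4) * Ψ * (τ * H)) := by
          gcongr
      _ = (H : ℝ) * (2 * (B : ℝ) ^ 2 + 4 * B * H * (Ck * (q : ℝ) ^ (ε / 4) * Ψ * τ)) := by ring
  have h2 : (H : ℝ) * S ^ 2 ≤ 2 * (B : ℝ) ^ 2 + 4 * B * H * (Ck * (q : ℝ) ^ (ε / 4) * Ψ * τ) := by
    have := h1
    rw [sq (H : ℝ), mul_assoc] at this
    exact le_of_mul_le_mul_left this hHpos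
  have h3 : S ^ 2 ≤ 2 * (B : ℝ) * r + 4 * B * (Ck * (q : ℝ) ^ (ε / 4) * Ψ * τ) := by
    -- divide by `H` and use `B² ≤ B H r`
    have hB2 : 2 * (B : ℝ) ^ 2 ≤ H * (2 * (B : ℝ) * r) := by
      have := mul_le_mul_of_nonneg_left hBr (by positivity : (0 : ℝ) ≤ 2 * B)
      calc 2 * (B : ℝ) ^ 2 = 2 * B * B := by ring
        _ ≤ 2 * B * (H * r) := this
        _ = H * (2 * (B : ℝ) * r) := by ring
    have : (H : ℝ) * S ^ 2 ≤ H * (2 * (B : ℝ) * r + 4 * B * (Ck * (q : ℝ) ^ (ε / 4) * Ψ * τ)) := by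
      calc (H : ℝ) * S ^ 2 ≤ 2 * (B : ℝ) ^ 2 + 4 * B * H * (Ck * (q : ℝ) ^ (ε / 4) * Ψ * τ) := h2
        _ ≤ H * (2 * (B : ℝ) * r) + 4 * B * H * (Ck * (q : ℝ) ^ (ε / 4) * Ψ * τ) :=
            add_le_add hB2 le_rfl
        _ = H * (2 * (B : ℝ) * r + 4 * B * (Ck * (q : ℝ) ^ (ε / 4) * Ψ * τ)) := by ring
    exact le_of_mul_le_mul_left this hHpos
  have h4 : S ^ 2 ≤ 4 * M * Cd * ((q : ℝ) ^ (ε / 4)) ^ 2 * ((B : ℝ) * r + B * Ψ) := by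
    have hτle : τ ≤ Cd * (q : ℝ) ^ (ε / 4) := by
      calc τ ≤ Cd * (q₀ : ℝ) ^ (ε / 4) := hCd q₀ hq₀.ne'
        _ ≤ Cd * (q : ℝ) ^ (ε / 4) :=
            mul_le_mul_of_nonneg_left (Real.rpow_le_rpow (Nat.cast_nonneg _) hq₀q hε4.le) hCd0.le
    have hr1 : (0 : ℝ) ≤ r := Nat.cast_nonneg _
    have hQ0 : (0 : ℝ) ≤ (q : ℝ) ^ (ε / 4) := by positivity
    -- `2 B r ≤ 4 M Cd Q² B r` and `4 B Ck Q Ψ τ ≤ 4 M Cd Q² B Ψ`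
    have e1 : 2 * (B : ℝ) * r ≤ 4 * M * Cd * ((q : ℝ) ^ (ε / 4)) ^ 2 * ((B : ℝ) * r) := by
      have hX : (1 : ℝ) ≤ M * Cd * ((q : ℝ) ^ (ε / 4)) ^ 2 :=
        one_le_mul_of_one_le_of_one_le (one_le_mul_of_one_le_of_one_le hM1 hCd1)
          (one_le_pow₀ hQ1)
      have hY : (0 : ℝ) ≤ (B : ℝ) * r := mul_nonneg hB1.le hr1
      have := mul_le_mul_of_nonneg_right
        (by linarith : (2 : ℝ) ≤ 4 * (M * Cd * ((q : ℝ) ^ (ε / 4)) ^ 2)) hY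
      calc 2 * (B : ℝ) * r = 2 * ((B : ℝ) * r) := by ring
        _ ≤ 4 * (M * Cd * ((q : ℝ) ^ (ε / 4)) ^ 2) * ((B : ℝ) * r) := this
        _ = _ := by ring
    have e2 : 4 * (B : ℝ) * (Ck * (q : ℝ) ^ (ε / 4) * Ψ * τ) ≤
        4 * M * Cd * ((q : ℝ) ^ (ε / 4)) ^ 2 * ((B : ℝ) * Ψ) := by
      have : Ck * (q : ℝ) ^ (ε / 4) * Ψ * τ ≤ M * Cd * ((q : ℝ) ^ (ε / 4)) ^ 2 * Ψ := by
        calc Ck * (q : ℝ) ^ (ε / 4) * Ψ * τ ≤ M * (q : ℝ) ^ (ε / 4) * Ψ * (Cd * (q : ℝ) ^ (ε / 4)) := by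
              gcongr
          _ = M * Cd * ((q : ℝ) ^ (ε / 4)) ^ 2 * Ψ := by ring
      have := mul_le_mul_of_nonneg_left this (by positivity : (0 : ℝ) ≤ 4 * B)
      calc 4 * (B : ℝ) * (Ck * (q : ℝ) ^ (ε / 4) * Ψ * τ) = 4 * B * (Ck * (q : ℝ) ^ (ε / 4) * Ψ * τ) := rfl
        _ ≤ 4 * B * (M * Cd * ((q : ℝ) ^ (ε / 4)) ^ 2 * Ψ) := this
        _ = _ := by ring
    calc S ^ 2 ≤ 2 * (B : ℝ) * r + 4 * B * (Ck * (q : ℝ) ^ (ε / 4) * Ψ * τ) := h3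
      _ ≤ 4 * M * Cd * ((q : ℝ) ^ (ε / 4)) ^ 2 * ((B : ℝ) * r) +
          4 * M * Cd * ((q : ℝ) ^ (ε / 4)) ^ 2 * ((B : ℝ) * Ψ) := add_le_add e1 e2
      _ = _ := by ring
  -- take square roots
  have h5 : S ≤ 2 * Real.sqrt (M * Cd) * (q : ℝ) ^ (ε / 4) * Real.sqrt ((B : ℝ) * r + B * Ψ) := by
    have hsq : S ≤ Real.sqrt (4 * M * Cd * ((q : ℝ) ^ (ε / 4)) ^ 2 * ((B : ℝ) * r + B * Ψ)) := by
      rw [← Real.sqrt_sq hS0]; exact Real.sqrt_le_sqrt h4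
    refine hsq.trans (le_of_eq ?_)
    rw [show 4 * M * Cd * ((q : ℝ) ^ (ε / 4)) ^ 2 * ((B : ℝ) * r + B * Ψ) =
        (2 * (q : ℝ) ^ (ε / 4)) ^ 2 * ((M * Cd) * ((B : ℝ) * r + B * Ψ)) by ring,
      Real.sqrt_mul (sq_nonneg _), Real.sqrt_sq (by positivity), Real.sqrt_mul (by positivity)]
    ring
  have h6 : Real.sqrt ((B : ℝ) * r + B * Ψ) ≤ hbBound (k + 1) q₀ qs Δ B := by
    rw [hΨ, hqs', hr]
    exact sqrt_le_hbBound_succ k q₀ qs Δ B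
  have h7 : (q : ℝ) ^ (ε / 4) ≤ (q : ℝ) ^ ε := Real.rpow_le_rpow_of_exponent_le hq1 (by linarith)
  calc S ≤ 2 * Real.sqrt (M * Cd) * (q : ℝ) ^ (ε / 4) * Real.sqrt ((B : ℝ) * r + B * Ψ) := h5
    _ ≤ 2 * Real.sqrt (M * Cd) * (q : ℝ) ^ ε * hbBound (k + 1) q₀ qs Δ B := by
        gcongr

/-- The non-degeneracy threshold at level `k`, degree `D`, from a level-`0` threshold `T`:
`thresh T 0 D = T D`, `thresh T (k+1) D = max (thresh T k (2D)) D`.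
[cite: HeathBrown2001LargestPrimeFactorCubic, §9 (induction on k, degrees doubling)] -/
def thresh (T : ℕ → ℕ) : ℕ → ℕ → ℕ
  | 0, D => T D
  | k + 1, D => max (thresh T k (2 * D)) D

/-- **All levels from level `0`** (Heath-Brown's induction on `k`, §9): if Theorem 2 holds at
level `0` for every degree `D` and every threshold `P ≥ T D`, then it holds at level `k` for
degree `D` and every threshold `P ≥ thresh T k D`.
[cite: HeathBrown2001LargestPrimeFactorCubic, §9 pp. 36–39] -/
theorem levelStmt_of_levelZero {T : ℕ → ℕ} (h0 : ∀ D P : ℕ, T D ≤ P → LevelStmt 0 D P) :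
    ∀ k D P : ℕ, thresh T k D ≤ P → LevelStmt k D P := by
  intro k
  induction k with
  | zero => intro D P hP; exact h0 D P hP
  | succ k ih =>
    intro D P hP
    simp only [thresh, max_le_iff] at hP
    exact levelStmt_succ hP.2 (ih (2 * D) P hP.1)

end Step

end ShortKloosterman

end Literature.NumberTheory.Sieve
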